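import Mathlib.CategoryTheory.Limits.Types.Coproducts
import Mathlib.CategoryTheory.Limits.Types.Products
import Mathlib.CategoryTheory.Limits.Types.Equalizers
import Mathlib.CategoryTheory.Limits.Preserves.Shapes.Terminal
import Mathlib.CategoryTheory.Limits.Preserves.Shapes.Equalizers
import Mathlib.CategoryTheory.Limits.Shapes.Equalizers
import Mathlib.CategoryTheory.SingleObj
import Mathlib.CategoryTheory.Countable
import Literature.AnabelianGeometry.SemiGraphs.TemperoidsHomProofs

/-!
# [SemiAnbd] Proposition 3.2: the fibre functor of a morphism of connected temperoids

Mochizuki, *Semi-graphs of anabelioids*, Publ. RIMS **42** (2006) 221–322, §3, Proposition 3.2,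
author's manuscript p. 35 [cite: MochizukiSemiAnbd2006, Prop 3.2 p.35].  Proof-only tool file (no
definitions) towards the named fact `TemperoidHomEqRes` of `Temperoids.lean` (every morphism of
connected temperoids `B^temp(Π₁) → B^temp(Π₂)` comes from a continuous homomorphism): for a functor
`F : B^temp(Π₂) ⥤ B^temp(Π₁)` preserving finite limits and countable colimits (Definition 3.1 (iii))
we read off, on underlying sets (the "fibre functor" `F ⋙ ι ⋙ forget`), what `F` does to

* one-point objects (they stay one-point: terminal objects),
* empty objects (they stay empty: initial objects),
* fixed-point-free endomorphisms (they stay fixed-point-free: the equalizer with the identity is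
  empty),
* quotients by a countable group of endomorphisms (they stay quotients: colimits indexed by the
  one-object category of the group).

All (co)limits in `B^temp(Π)` are computed on underlying sets, because `B^temp(Π)` is closed under
finite limits and countable colimits in `Π`-sets (`TemperoidsHomProofs.lean`) and the forgetful
functor of `Π`-sets preserves and reflects (co)limits.
-/

namespace Literature.AnabelianGeometry.SemiGraphs

namespace BTemp

open CategoryTheory CategoryTheory.Limits Topology

universe u

variable {G₁ : Type u} [Group G₁] [TopologicalSpace G₁]
  {G₂ : Type u} [Group G₂] [TopologicalSpace G₂]

/-! ### The fibre functors preserve and reflect the relevant (co)limits -/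

/-- The forgetful functor `B^temp(Π) ⥤ Type` preserves finite limits.
[cite: MochizukiSemiAnbd2006, Def 3.1(iii) p.33] -/
theorem fibre_preservesLimitsOfShape (G : Type u) [Group G] [TopologicalSpace G] (J : Type)
    [SmallCategory J] [FinCategory J] :
    PreservesLimitsOfShape J ((temperedAction G).ι ⋙ Action.forget (Type u) G) := by
  haveI := temperedAction_isClosedUnderLimitsOfShape (G := G) J
  infer_instance

/-- The forgetful functor `B^temp(Π) ⥤ Type` preserves countable colimits.
[cite: MochizukiSemiAnbd2006, Def 3.1(iii) p.33] -/
theorem fibre_preservesColimitsOfShape (G : Type u) [Group G] [TopologicalSpace G]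
    [IsTopologicalGroup G] (J : Type) [SmallCategory J] [CountableCategory J] :
    PreservesColimitsOfShape J ((temperedAction G).ι ⋙ Action.forget (Type u) G) := by
  haveI := temperedAction_isClosedUnderColimitsOfShape (G := G) J
  infer_instance

/-- The forgetful functor `B^temp(Π) ⥤ Type` reflects limits. [cite: MochizukiSemiAnbd2006, §3 p.33] -/
theorem fibre_reflectsLimitsOfShape (G : Type u) [Group G] [TopologicalSpace G] (J : Type)
    [SmallCategory J] :
    ReflectsLimitsOfShape J ((temperedAction G).ι ⋙ Action.forget (Type u) G) := by
  infer_instance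

/-- The forgetful functor `B^temp(Π) ⥤ Type` reflects colimits. [cite: MochizukiSemiAnbd2006, §3 p.33] -/
theorem fibre_reflectsColimitsOfShape (G : Type u) [Group G] [TopologicalSpace G] (J : Type)
    [SmallCategory J] :
    ReflectsColimitsOfShape J ((temperedAction G).ι ⋙ Action.forget (Type u) G) := by
  infer_instance

variable (F : BTemp G₂ ⥤ BTemp G₁) (hlim : PreservesFiniteLimits F)
  (hcolim : ∀ (J : Type) [SmallCategory J] [CountableCategory J], PreservesColimitsOfShape J F)

include hlim in
/-- The fibre functor of `F` preserves finite limits. [cite: MochizukiSemiAnbd2006, Def 3.1(iii) p.33] -/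
theorem fibreFunctor_preservesLimitsOfShape (J : Type) [SmallCategory J] [FinCategory J] :
    PreservesLimitsOfShape J (F ⋙ (temperedAction G₁).ι ⋙ Action.forget (Type u) G₁) := by
  haveI := fibre_preservesLimitsOfShape G₁ J
  haveI : PreservesLimitsOfShape J F := hlim.preservesFiniteLimits J
  infer_instance

include hcolim in
/-- The fibre functor of `F` preserves countable colimits.
[cite: MochizukiSemiAnbd2006, Def 3.1(iii) p.33] -/
theorem fibreFunctor_preservesColimitsOfShape [IsTopologicalGroup G₁] (J : Type) [SmallCategory J]
    [CountableCategory J] :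
    PreservesColimitsOfShape J (F ⋙ (temperedAction G₁).ι ⋙ Action.forget (Type u) G₁) := by
  haveI := fibre_preservesColimitsOfShape G₁ J
  haveI : PreservesColimitsOfShape J F := hcolim J
  infer_instance

/-! ### One-point and empty objects -/

include hlim in
/-- `F` maps one-point objects to one-point objects (it preserves the terminal object).
[cite: MochizukiSemiAnbd2006, Prop 3.2 p.35] -/
theorem map_singleton (X : BTemp G₂) [Unique X.obj.V] :
    Nonempty (F.obj X).obj.V ∧ Subsingleton (F.obj X).obj.V := by
  let Φ₂ := (temperedAction G₂).ι ⋙ Action.forget (Type u) G₂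
  let Φ₁ := (temperedAction G₁).ι ⋙ Action.forget (Type u) G₁
  -- `X` is terminal in `B^temp(Π₂)`
  have e : X.obj.V ≃ PUnit.{u + 1} := Equiv.equivPUnit _
  have hX : IsTerminal (Φ₂.obj X) :=
    (Types.isTerminalPUnit.ofIso (e.toIso).symm : IsTerminal (X.obj.V))
  haveI := fibre_reflectsLimitsOfShape G₂ (Discrete PEmpty.{1})
  have hX' : IsTerminal X := IsTerminal.isTerminalOfObj Φ₂ X hX
  haveI : PreservesLimitsOfShape (Discrete PEmpty.{1}) F := hlim.preservesFiniteLimits _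
  have hFX : IsTerminal (F.obj X) := IsTerminal.isTerminalObj F X hX'
  haveI := fibre_preservesLimitsOfShape G₁ (Discrete PEmpty.{1})
  have hT : IsTerminal (Φ₁.obj (F.obj X)) := IsTerminal.isTerminalObj Φ₁ (F.obj X) hFX
  refine ⟨⟨(hT.from (PUnit : Type u)) PUnit.unit⟩, ⟨fun a b => ?_⟩⟩
  have h := hT.hom_ext (TypeCat.ofHom fun _ : PUnit.{u + 1} => a)
    (TypeCat.ofHom fun _ : PUnit.{u + 1} => b)
  exact congrArg (fun k : (PUnit : Type u) ⟶ Φ₁.obj (F.obj X) => k PUnit.unit) h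

include hcolim in
/-- `F` maps empty objects to empty objects (it preserves the initial object).
[cite: MochizukiSemiAnbd2006, Prop 3.2 p.35] -/
theorem map_isEmpty [IsTopologicalGroup G₁] (X : BTemp G₂) [IsEmpty X.obj.V] :
    IsEmpty (F.obj X).obj.V := by
  let Φ₂ := (temperedAction G₂).ι ⋙ Action.forget (Type u) G₂
  let Φ₁ := (temperedAction G₁).ι ⋙ Action.forget (Type u) G₁
  obtain ⟨hX⟩ := (Types.initial_iff_empty (Φ₂.obj X)).mpr (inferInstance : IsEmpty X.obj.V)
  haveI := fibre_reflectsColimitsOfShape G₂ (Discrete PEmpty.{1})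
  have hX' : IsInitial X := IsInitial.isInitialOfObj Φ₂ X hX
  haveI : PreservesColimitsOfShape (Discrete PEmpty.{1}) F := hcolim _
  have hFX : IsInitial (F.obj X) := IsInitial.isInitialObj F X hX'
  haveI := fibre_preservesColimitsOfShape G₁ (Discrete PEmpty.{1})
  have hI : IsInitial (Φ₁.obj (F.obj X)) := IsInitial.isInitialObj Φ₁ (F.obj X) hFX
  exact (Types.initial_iff_empty _).mp ⟨hI⟩

/-! ### Fixed-point-free endomorphisms -/

include hlim hcolim in
/-- `F` maps fixed-point-free endomorphisms to fixed-point-free endomorphisms (the equalizer with the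
identity is empty, and `F` preserves equalizers and the initial object).
[cite: MochizukiSemiAnbd2006, Prop 3.2 p.35] -/
theorem map_fixedPointFree [IsTopologicalGroup G₁] {X : BTemp G₂} (f : X ⟶ X)
    (hf : ∀ x : X.obj.V, f.hom.hom x ≠ x) (y : (F.obj X).obj.V) : (F.map f).hom.hom y ≠ y := by
  intro hy
  let Φ₁ := (temperedAction G₁).ι ⋙ Action.forget (Type u) G₁
  haveI := temperedAction_isClosedUnderLimitsOfShape (G := G₂) WalkingParallelPair
  haveI : HasLimitsOfShape WalkingParallelPair (BTemp G₂) := inferInstance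
  -- the equalizer of `f` and the identity is empty
  let E : BTemp G₂ := equalizer f (𝟙 X)
  haveI : IsEmpty E.obj.V := ⟨fun x₀ => by
    have h := congrArg (fun k : E ⟶ X => k.hom.hom x₀) (equalizer.condition f (𝟙 X))
    exact hf _ h⟩
  have hE : IsEmpty (F.obj E).obj.V := map_isEmpty F hcolim E
  -- `F ⋙ fibre` preserves the equalizer
  haveI := fibreFunctor_preservesLimitsOfShape F hlim WalkingParallelPair
  have l := isLimitOfHasEqualizerOfPreservesLimit (F ⋙ Φ₁) f (𝟙 X)
  have hk : (TypeCat.ofHom fun _ : PUnit.{u + 1} => y) ≫ (F ⋙ Φ₁).map f =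
      (TypeCat.ofHom fun _ : PUnit.{u + 1} => y) ≫ (F ⋙ Φ₁).map (𝟙 X) := by
    rw [CategoryTheory.Functor.map_id]
    refine ConcreteCategory.hom_ext _ _ fun x => ?_
    simp only [types_comp_apply, TypeCat.ofHom_apply]
    exact hy
  obtain ⟨k, -⟩ := Fork.IsLimit.lift' l _ hk
  exact hE.false (k PUnit.unit)

/-! ### Quotients by a countable group of endomorphisms -/

include hcolim in
/-- `F` maps quotients to quotients: if a countable group `K` acts on `X` by endomorphisms `a k` and
`π : X ⟶ W` is surjective with fibres the `K`-orbits (so that `W = X/K` is the colimit of the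
action diagram `SingleObj K ⥤ B^temp(Π₂)`), then `F π` is surjective with fibres the `K`-orbits
for the endomorphisms `F (a k)`. [cite: MochizukiSemiAnbd2006, Prop 3.2 p.35] -/
theorem map_quotient [IsTopologicalGroup G₁] {K : Type} [Group K] [Countable K] {X W : BTemp G₂}
    (a : K →* End X) (π : X ⟶ W) (hπ : ∀ k, a k ≫ π = π)
    (hsurj : ∀ w : W.obj.V, ∃ x : X.obj.V, π.hom.hom x = w)
    (hfib : ∀ x x' : X.obj.V, π.hom.hom x = π.hom.hom x' → ∃ k, (a k).hom.hom x = x') :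
    (∀ z : (F.obj W).obj.V, ∃ y : (F.obj X).obj.V, (F.map π).hom.hom y = z) ∧
      ∀ y y' : (F.obj X).obj.V, (F.map π).hom.hom y = (F.map π).hom.hom y' ↔
        ∃ k, (F.map (a k)).hom.hom y = y' := by
  classical
  let Φ₂ := (temperedAction G₂).ι ⋙ Action.forget (Type u) G₂
  let Φ₁ := (temperedAction G₁).ι ⋙ Action.forget (Type u) G₁
  haveI : CountableCategory (SingleObj K) :=
    { countableObj := by unfold SingleObj Quiver.SingleObj; infer_instance
      countableHom := fun _ _ => (inferInstance : Countable K) }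
  -- the action diagram and the quotient cocone
  let D : SingleObj K ⥤ BTemp G₂ := SingleObj.functor a
  let c : Cocone D :=
    { pt := W
      ι := { app := fun _ => π
             naturality := fun _ _ k => by
               show a k ≫ π = π ≫ 𝟙 W
               rw [Category.comp_id]
               exact hπ k } }
  -- it is a colimit: check on underlying sets
  haveI := fibre_reflectsColimitsOfShape G₂ (SingleObj K)
  have hc0 : ((D ⋙ Φ₂).coconeTypesEquiv.symm (Φ₂.mapCocone c)).IsColimit := by
    refine ⟨⟨?_, ?_⟩⟩
    · intro p q h
      induction p using Quot.ind with | _ p =>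
      induction q using Quot.ind with | _ q =>
      obtain ⟨j, x⟩ := p
      obtain ⟨j', x'⟩ := q
      obtain rfl : j = j' := Subsingleton.elim _ _
      change π.hom.hom x = π.hom.hom x' at h
      obtain ⟨k, hk⟩ := hfib x x' h
      exact Quot.sound ⟨k, hk.symm⟩
    · rw [Functor.CoconeTypes.descColimitType_surjective_iff]
      intro z
      obtain ⟨x, hx⟩ := hsurj z
      exact ⟨SingleObj.star K, x, hx⟩
  have hc : IsColimit c :=
    isColimitOfReflects Φ₂ ((Types.isColimit_iff_coconeTypesIsColimit _).mpr hc0).some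
  -- push through the fibre functor of `F`
  haveI := fibreFunctor_preservesColimitsOfShape F hcolim (SingleObj K)
  have hFc := (Types.isColimit_iff_coconeTypesIsColimit ((F ⋙ Φ₁).mapCocone c)).mp
    ⟨isColimitOfPreserves (F ⋙ Φ₁) hc⟩
  -- bookkeeping for the endomorphisms `F (a k)`
  have hF1 : ∀ y : (F.obj X).obj.V, (F.map (a 1)).hom.hom y = y := by
    intro y
    rw [map_one, show (1 : End X) = 𝟙 X from rfl, F.map_id]
    rfl
  have hFmul : ∀ (k k' : K) (y : (F.obj X).obj.V),
      (F.map (a (k * k'))).hom.hom y = (F.map (a k)).hom.hom ((F.map (a k')).hom.hom y) := by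
    intro k k' y
    rw [map_mul, End.mul_def, F.map_comp]
    rfl
  refine ⟨fun z => ?_, fun y y' => ⟨fun h => ?_, ?_⟩⟩
  · obtain ⟨_, y, hy⟩ := hFc.ι_jointly_surjective z
    exact ⟨y, hy⟩
  · have h1 : (D ⋙ F ⋙ Φ₁).ιColimitType (SingleObj.star K) y =
        (D ⋙ F ⋙ Φ₁).ιColimitType (SingleObj.star K) y' := by
      rw [← hFc.equiv_symm_ι_apply, ← hFc.equiv_symm_ι_apply]
      exact congrArg _ h
    rw [Functor.ιColimitType_eq_iff] at h1
    have key : ∀ p p' : Σ j : SingleObj K, (D ⋙ F ⋙ Φ₁).obj j,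
        Relation.EqvGen (D ⋙ F ⋙ Φ₁).ColimitTypeRel p p' →
        ∃ k : K, (F.map (a k)).hom.hom p.2 = p'.2 := by
      intro p p' hpp
      induction hpp with
      | rel p p' hr =>
        obtain ⟨f, hf⟩ := hr
        exact ⟨f, hf.symm⟩
      | refl p => exact ⟨1, hF1 _⟩
      | symm p p' _ ih =>
        obtain ⟨k, hk⟩ := ih
        refine ⟨k⁻¹, ?_⟩
        rw [← hk, ← hFmul, inv_mul_cancel, hF1]
      | trans p p' p'' _ _ ih ih' =>
        obtain ⟨k, hk⟩ := ih
        obtain ⟨k', hk'⟩ := ih'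
        exact ⟨k' * k, by rw [hFmul, hk, hk']⟩
    exact key _ _ h1
  · rintro ⟨k, rfl⟩
    change (F.map π).hom.hom y = (F.map (a k) ≫ F.map π).hom.hom y
    rw [← F.map_comp, hπ k]

end BTemp

end Literature.AnabelianGeometry.SemiGraphs
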